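import Summits.AtomisticToContinuum.Crystallization.Theorems.PalmUnimodularRigidityMinimiserShellsTwoLevelMono
import Literature.Probability.Process.PointStationaryTransfer
import Literature.MathematicalPhysics.StatisticalMechanics.MuGSC

/-!
# Line `palm-elastic-tail` for crux `MinimiserShells` (stmt-AtomisticToContinuum-9225) — strategist s2 ALTERNATIVE line
# (lead c24 reshape r1: stub D `stub_palmTransfer` ↦ `stub_palmTransferRoot` — the law-level gap is assumed only for
#  laws whose ROOT shell is a.s. coarse-good; the upgrade "a.s. at the root ⇒ a.s. at every point" is no longer inside the
#  stub but PROVED in the glue (`ae_forall_looseGoodShell`, from Literature `IsPointStationaryLaw.ae_forall_map_sub`).)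

Registered alongside (never instead of) the lead's live skeleton `Lines/exact_elastic_split.lean` (r2: conjecture + finite-cluster
dyadic rungs).  Same exact core `LennardJonesCoarseShellGapConjecture` (every line must carry it: `MinimiserShells → ShellGap (1/20)`,
p159569), but the coarse-to-fine half `CoarseToFineShellGapAllStmt` is cut BY METHOD REGIME instead of by dyadic level:

* `stub_shallowRungs` — ONE periodic two-level statement `CoarseToFineAt (1/20) (1/1024)` (tolerance 6 % → 1.1 %): the genuinely
  anharmonic part (at 6 % looseness the bond-wise dynamical matrix is indefinite), left as the second hard stub next to the conjecture;
* the DEEP TAIL `θ ≤ 1/1024` done at the LAW level (no clusters, no boundary layers):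
  - `stub_fineBarlowChart` — an everywhere-`LooseGoodShell (3/2048)` hard-core set IS a bond-bijective image of a Barlow stacking
    (port of the CLOSED crux `ShellsToBarlowChart` (stmt-9227, line develop-the-model-growth-descent) from tolerance `a/100`, radius `5a/4`
    to tolerance `(1/100+3/2048)a`, radius `(5/4-3/2048)a`; its certified margins — equator propagation needs extra tolerance < 0.0032,
    bond window 28/25 needs θ < 0.06 — hold at 3/2048 ≈ 0.00146);
  - `stub_stationaryElasticGap` — for a POINT-STATIONARY law of everywhere-good CHARTED configurations, a density `≥ t` of
    `(1/4096)/2^k`-bad roots costs mean root energy `≥ e⋆ + κ`: the elastic step in the Palm frame, where the first-order (pre-stress)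
    term is killed by the mass-transport principle (mean bond vector is additive along the chart, hence affine, hence annihilated by
    zero mean deviation) instead of by boundary layers, and coercivity is a Brillouin-zone (Herglotz–Bochner) inequality;
  - `stub_palmTransfer` — that law-level gap implies the periodic rung `CoarseToFineAt ((1/1024)/2^k) ((1/1024)/2^(k+1))`
    (contrapositive: near-optimal periodic counterexamples → Palm limit law (NecessityLimit genre) which is a.s. EVERYWHERE coarse-good
    (closed-set portmanteau at the slackened level `3/2048·2^-k > 1/1024·2^-k`, then Mecke: a.s.-at-root ⇒ a.s.-everywhere), has
    fine-bad mass `≥ t` (open-set portmanteau at the slackened level `1/4096·2^-k < 1/2048·2^-k`) and mean energy `e⋆` — contradiction).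
The composition `MinimiserShells_of` is kernel-checked below (ladder `θ 0 = 1/20`, `θ (j+1) = (1/1024)/2^j`, `child_of_ladder`,
`shellGapAll_of_coarse_and_child`, `minimiserShells_of_shellGapAll`).
-/

open MeasureTheory
open scoped ENNReal BigOperators Classical

namespace Summit.AtomisticToContinuum.Crystallization.Cruxes.MinimiserShells.PalmElasticTail

open Literature.MathematicalPhysics.StatisticalMechanics (lennardJones PeriodicConfiguration IsHaggSeq barlowStacking)
open Summit.AtomisticToContinuum.Crystallization.Theses.PalmUnimodularRigidity (MinimiserShells)
open Summit.AtomisticToContinuum.Crystallization.Theorems.MinimiserShells.Negative.LoadBearing (eStar)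
open Summit.AtomisticToContinuum.Crystallization.Theorems.PalmUnimodularRigidityMinimiserShells.Residual
open Summit.AtomisticToContinuum.Crystallization.Theorems.PalmUnimodularRigidityMinimiserShells.ExactResidual
open Summit.AtomisticToContinuum.Crystallization.Theorems.PalmUnimodularRigidityMinimiserShells.TwoLevel
open Summit.AtomisticToContinuum.Crystallization
open Literature.Probability.Process (IsPointStationaryLaw count_restrict_singleton_ne_zero_iff map_sub_count_restrict
  floorNorm_preimage_subset_closedBall measurableSet_floorNorm_preimage)
open Literature.MathematicalPhysics.StatisticalMechanics (UniformlyDiscrete)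

/-- Shorthand used only in docstrings/comments: `E3 = EuclideanSpace ℝ (Fin 3)`. Statements below are written over Mathlib/tree
declarations only (no local definitions), so each stub can land verbatim in a `Theorems/` file. -/
local notation "E3" => EuclideanSpace ℝ (Fin 3)

/-! ## Stub A — the named open core (shared with every line of this crux) -/

/-- **Stub A (OPEN PROBLEM, by name).** `LennardJonesCoarseShellGapConjecture = ShellGap (1/20)` (p159569); necessary for the crux
(`lennardJonesCoarseShellGapConjecture_of_minimiserShells`). -/
theorem stub_lennardJonesCoarseShellGapConjecture : LennardJonesCoarseShellGapConjecture := by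
  sorry

/-! ## Stub S — the shallow (anharmonic) rung, periodic two-level form -/

/-- **Stub S (shallow rung, XL).** Among `1/3`-separated periodic configurations whose `1/20`-loosely-bad root fraction is `≤ s`, a
`1/1024`-loosely-bad root fraction `≥ t` costs `≥ e⋆ + κ(t)` per particle once `s ≤ s₀(t)`.  Necessary for the crux
(`MinimiserShells → ShellGap (1/1024) → CoarseToFineAt (1/20) (1/1024)`, `coarseToFineAt_of_shellGap`).  This is the regime where the
configuration is only known to be 6 %-close to kissing patterns: genuinely non-convex local landscape; no harmonic shortcut. -/
theorem stub_shallowRungs : CoarseToFineAt (1 / 20) (1 / 1024) := by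
  sorry

/-! ## Stub B — fine Barlow chart (port of the closed crux `ShellsToBarlowChart` to tolerance `1/100 + 3/2048`) -/

/-- **Stub B (fine Barlow chart, L — a port).** A nonempty set all of whose points have a `(3/2048)`-loosely-good re-rooted shell
(12 atoms within `(1/100 + 3/2048)·a` of a scaled rotated FCC/HCP kissing pattern inside radius `(5/4 - 3/2048)·a`, nothing else there)
is the bond-bijective image of a Barlow stacking — conclusion copied verbatim from `ShellsToBarlowChart` (stmt-9227, CLOSED).  The
closed proof's certified margins survive: `equatorPropagation_margin` needs extra tolerance `< 0.0032`, the bond window `28/25` needs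
`(1+θ')·a_max < 28/25 < (√2-θ')·0.9·…` i.e. `θ' < 0.06`; here `θ' = 3/2048 ≈ 0.0015`. Hard-core separation is implied by the shells
(`hardCore_bounds`) and therefore not assumed. -/
theorem stub_fineBarlowChart :
    ∀ S : Set (EuclideanSpace ℝ (Fin 3)), S.Nonempty →
      (∀ x ∈ S, LooseGoodShell (3 / 2048)
        ((Measure.count : Measure (EuclideanSpace ℝ (Fin 3))).restrict ((fun z => z - x) '' S))) →
      ∃ s : ℤ → ℤ, IsHaggSeq s ∧
        ∃ Φ : EuclideanSpace ℝ (Fin 3) → EuclideanSpace ℝ (Fin 3),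
          Set.BijOn Φ (barlowStacking 1 (Real.sqrt (2 / 3)) s) S ∧
          ∀ p ∈ barlowStacking 1 (Real.sqrt (2 / 3)) s, ∀ q ∈ barlowStacking 1 (Real.sqrt (2 / 3)) s,
            (dist p q = 1 ↔ (0 < dist (Φ p) (Φ q) ∧ dist (Φ p) (Φ q) ≤ 28 / 25)) := by
  sorry

/-! ## Stub C — the stationary elastic gap at the deep levels (the NEW lever) -/

/-- **Stub C (stationary elastic gap, deep level `k`; L/XL — the line's hardest new stub).**  Fix `k` and `t > 0`.  There is `κ > 0`
such that every probability law `P` on rooted configurations which is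
(i) a.s. a `1/3`-hard-core set containing the root, ALL of whose points are `(3/2048)/2^k`-loosely good, and which is a bond-bijective
    Barlow image (the chart of Stub B, put into the hypothesis so that this stub is pure lattice elasticity),
(ii) point-stationary (Mecke / mass-transport identity, verbatim as in the crux),
and (iii) gives mass `≥ t` to the `(1/4096)/2^k`-loosely-BAD roots (through any measurable `B` agreeing with `LooseGoodShell` on
hard-core configurations — `stub_looseGoodShellMeasurable` provides one),
has mean root energy `≥ e⋆ + κ`.  Intended proof: along the chart every configuration is a displacement field on a Barlow stacking with
all bond distortions `≤ (1/100 + 3/2048·2^-k)·a`; by (ii) the mean bond vector is additive in the stacking vector, hence affine (`F̄`),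
so the first-order term of the expansion of `E_P[h]` about `F̄` vanishes identically (zero mean deviation — no boundary, no pre-stress
bookkeeping), the zeroth-order term is the Cauchy–Born energy `W(F̄) ≥ e⋆`, the harmonic term is `≥ c·E_P[|δ|²]` by a certified
Brillouin-zone inequality (phonon + Cauchy–Born stability of LJ fcc/hcp, Herglotz–Bochner for the stationary deviation field), the cubic
remainder is `O(1.2 %)·harmonic`, and a `(1/4096)/2^k`-bad root forces `E[|δ|²] ≳ (gap between the two tolerances)²` nearby. -/
theorem stub_stationaryElasticGap :
    ∀ k : ℕ, ∀ t : ℝ, 0 < t → ∃ κ : ℝ, 0 < κ ∧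
      ∀ P : Measure (Measure (EuclideanSpace ℝ (Fin 3))), IsProbabilityMeasure P →
        (∀ᵐ μ ∂P, ∃ S : Set (EuclideanSpace ℝ (Fin 3)), (0 : EuclideanSpace ℝ (Fin 3)) ∈ S ∧
            (∀ x ∈ S, ∀ y ∈ S, x ≠ y → (1 : ℝ) / 3 ≤ dist x y) ∧
            μ = (Measure.count : Measure (EuclideanSpace ℝ (Fin 3))).restrict S ∧
            (∀ x ∈ S, LooseGoodShell ((3 / 2048 : ℝ) / 2 ^ k)
              ((Measure.count : Measure (EuclideanSpace ℝ (Fin 3))).restrict ((fun z => z - x) '' S))) ∧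
            (∃ s : ℤ → ℤ, IsHaggSeq s ∧
              ∃ Φ : EuclideanSpace ℝ (Fin 3) → EuclideanSpace ℝ (Fin 3),
                Set.BijOn Φ (barlowStacking 1 (Real.sqrt (2 / 3)) s) S ∧
                ∀ p ∈ barlowStacking 1 (Real.sqrt (2 / 3)) s, ∀ q ∈ barlowStacking 1 (Real.sqrt (2 / 3)) s,
                  (dist p q = 1 ↔ (0 < dist (Φ p) (Φ q) ∧ dist (Φ p) (Φ q) ≤ 28 / 25)))) →
        (∀ g : Measure (EuclideanSpace ℝ (Fin 3)) → EuclideanSpace ℝ (Fin 3) → ℝ≥0∞, Measurable (Function.uncurry g) →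
            ∫⁻ μ, ∫⁻ y, g μ y ∂μ ∂P = ∫⁻ μ, ∫⁻ y, g (Measure.map (fun z => z - y) μ) (-y) ∂μ ∂P) →
        ∀ B : Set (Measure (EuclideanSpace ℝ (Fin 3))), MeasurableSet B →
          (∀ μ : Measure (EuclideanSpace ℝ (Fin 3)),
              (∃ S : Set (EuclideanSpace ℝ (Fin 3)), (0 : EuclideanSpace ℝ (Fin 3)) ∈ S ∧
                (∀ x ∈ S, ∀ y ∈ S, x ≠ y → (1 : ℝ) / 3 ≤ dist x y) ∧
                μ = (Measure.count : Measure (EuclideanSpace ℝ (Fin 3))).restrict S) →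
              (μ ∈ B ↔ LooseGoodShell ((1 / 4096 : ℝ) / 2 ^ k) μ)) →
          ENNReal.ofReal t ≤ P Bᶜ →
          eStar + κ ≤ ∫ μ, (∫ y, lennardJones ‖y‖ ∂μ) / 2 ∂P := by
  sorry

/-! ## Stub D' — Palm transfer at the ROOT level: the law-level gap gives the periodic deep rung -/

/-- **Stub D' (Palm transfer, root level; L — landed genre; lead c24 reshape of the strategist's `stub_palmTransfer`).**
Fix `k`.  Suppose that for every `t > 0` some `κ > 0` bounds below by `e⋆ + κ` the mean root energy of every probability
law `P` on rooted configurations which is (i) a.s. a rooted `1/3`-hard-core counting measure whose ROOT shell is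
`(3/2048)/2^k`-loosely good, (ii) point-stationary (Mecke identity, verbatim as in the crux), and (iii) gives mass `≥ t`
to the complement of any measurable `B` agreeing with `LooseGoodShell ((1/4096)/2^k)` on rooted `1/3`-hard-core
configurations.  Then the periodic two-level rung `CoarseToFineAt ((1/1024)/2^k) ((1/1024)/2^(k+1))` holds.
Proof (genre of the landed `NecessitySandwich.stub_necessity_sandwich`): if the rung fails for `t`, pick `1/3`-separated
periodic `Qₙ` with `(1/1024)/2^k`-bad motif fraction `≤ 1/(n+1)`, `(1/1024)/2^(k+1)`-bad fraction `≥ t`, energy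
`< e⋆ + 1/(n+1)`; cut blocks with the TWO local predicates (`PeriodicAssembly.exists_blocks₂` with
`NecessityBlocks.looseGood_congr_of_local`); take the Benjamini–Schramm limit (`NecessityLimit.stub_necessity_limit`):
`P` probability, a.s. `IsRootedHardCore (1/3)`, `IsPointStationaryLaw P`, `meanRootEnergy P = lim = e⋆` (squeeze with
`ChargedEnergyGapNegative.card_mul_eStar_le`).  COARSE side: the hull `T₁` (as in `NecessitySandwich.closed_hull`) of the
`(1/1024)/2^k`-loosely-GOOD hard-core configurations has `P T₁ = 1` (else the density clause with `P T₁ < ρ < 1` contradicts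
"eventually `≥ (1 - 1/(n+1) - εₙ)·M` block particles are coarse-good, hence in `T₁`" via `card_le_card_hull`), `T₁` is
measurable (image of a closed set under the measurable embedding `toMeasure`, cf. `NecessityLimit.isClosed_preimage_toMeasure`,
or re-derive the limit keeping `Q.map e`) so a.s. `μ ∈ T₁`, and `T₁ ∩ hard-core ⊆ LooseGoodShell ((3/2048)/2^k)` by robustness
(`NecessityRobust.stub_necessity_robust` / `shell_transfer` with slack `(3/2048 - 2/2048)/2^k`).  FINE side: the hull `T₂` of the
`(1/1024)/2^(k+1)`-loosely-BAD configurations has `P T₂ ≥ t/2` (density clause, `card_le_card_hull`) and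
`T₂ ∩ hard-core ⊆ ¬ LooseGoodShell ((1/4096)/2^k)` (robustness, slack `(2 - 1)/4096/2^k`), so `P Bᶜ ≥ P T₂ ≥ t/2` for every
admissible `B`.  The hypothesis at `t/2` then gives `e⋆ + κ ≤ meanRootEnergy P = e⋆`, absurd. -/
theorem stub_palmTransferRoot :
    ∀ k : ℕ,
      (∀ t : ℝ, 0 < t → ∃ κ : ℝ, 0 < κ ∧
        ∀ P : Measure (Measure (EuclideanSpace ℝ (Fin 3))), IsProbabilityMeasure P →
          (∀ᵐ μ ∂P, (∃ S : Set (EuclideanSpace ℝ (Fin 3)), (0 : EuclideanSpace ℝ (Fin 3)) ∈ S ∧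
              (∀ x ∈ S, ∀ y ∈ S, x ≠ y → (1 : ℝ) / 3 ≤ dist x y) ∧
              μ = (Measure.count : Measure (EuclideanSpace ℝ (Fin 3))).restrict S) ∧
              LooseGoodShell ((3 / 2048 : ℝ) / 2 ^ k) μ) →
          (∀ g : Measure (EuclideanSpace ℝ (Fin 3)) → EuclideanSpace ℝ (Fin 3) → ℝ≥0∞, Measurable (Function.uncurry g) →
              ∫⁻ μ, ∫⁻ y, g μ y ∂μ ∂P = ∫⁻ μ, ∫⁻ y, g (Measure.map (fun z => z - y) μ) (-y) ∂μ ∂P) →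
          ∀ B : Set (Measure (EuclideanSpace ℝ (Fin 3))), MeasurableSet B →
            (∀ μ : Measure (EuclideanSpace ℝ (Fin 3)),
                (∃ S : Set (EuclideanSpace ℝ (Fin 3)), (0 : EuclideanSpace ℝ (Fin 3)) ∈ S ∧
                  (∀ x ∈ S, ∀ y ∈ S, x ≠ y → (1 : ℝ) / 3 ≤ dist x y) ∧
                  μ = (Measure.count : Measure (EuclideanSpace ℝ (Fin 3))).restrict S) →
                (μ ∈ B ↔ LooseGoodShell ((1 / 4096 : ℝ) / 2 ^ k) μ)) →
            ENNReal.ofReal t ≤ P Bᶜ →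
            eStar + κ ≤ ∫ μ, (∫ y, lennardJones ‖y‖ ∂μ) / 2 ∂P) →
      CoarseToFineAt ((1 / 1024 : ℝ) / 2 ^ k) ((1 / 1024 : ℝ) / 2 ^ (k + 1)) := by
  sorry

/-! ## Glue (sorry-free) -/

/-- Level arithmetic: `(3/2048)/2^k ≤ 3/2048`. -/
theorem coarseLevel_le (k : ℕ) : (3 / 2048 : ℝ) / 2 ^ k ≤ 3 / 2048 :=
  div_le_self (by norm_num) (one_le_pow₀ (by norm_num))

theorem coarseLevel_nonneg (k : ℕ) : (0 : ℝ) ≤ (3 / 2048 : ℝ) / 2 ^ k := by positivity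

/-- **Everything shows at the root, for loosely-good shells** (lead c24; the former inside of `stub_palmTransfer`).  Under a
point-stationary law almost surely carried by rooted `1/3`-hard-core counting measures whose ROOT shell is `θ`-loosely good,
almost surely the shell re-rooted at EVERY point is `θ`-loosely good: hard-core configurations are locally finite
(`UniformlyDiscrete.finite_inter_closedBall`), so Literature `IsPointStationaryLaw.ae_forall_map_sub` (Aldous–Lyons
"everything shows at the root", point-process form) applies to `p := LooseGoodShell θ`; re-rooting a counting measure is
`map_sub_count_restrict`. -/
theorem ae_forall_looseGoodShell {θ : ℝ} {P : Measure (Measure (EuclideanSpace ℝ (Fin 3)))}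
    (hroot : ∀ᵐ μ ∂P, (∃ S : Set (EuclideanSpace ℝ (Fin 3)), (0 : EuclideanSpace ℝ (Fin 3)) ∈ S ∧
        (∀ x ∈ S, ∀ y ∈ S, x ≠ y → (1 : ℝ) / 3 ≤ dist x y) ∧
        μ = (Measure.count : Measure (EuclideanSpace ℝ (Fin 3))).restrict S) ∧ LooseGoodShell θ μ)
    (hstat : ∀ g : Measure (EuclideanSpace ℝ (Fin 3)) → EuclideanSpace ℝ (Fin 3) → ℝ≥0∞, Measurable (Function.uncurry g) →
        ∫⁻ μ, ∫⁻ y, g μ y ∂μ ∂P = ∫⁻ μ, ∫⁻ y, g (Measure.map (fun z => z - y) μ) (-y) ∂μ ∂P) :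
    ∀ᵐ μ ∂P, ∃ S : Set (EuclideanSpace ℝ (Fin 3)), (0 : EuclideanSpace ℝ (Fin 3)) ∈ S ∧
        (∀ x ∈ S, ∀ y ∈ S, x ≠ y → (1 : ℝ) / 3 ≤ dist x y) ∧
        μ = (Measure.count : Measure (EuclideanSpace ℝ (Fin 3))).restrict S ∧
        ∀ x ∈ S, LooseGoodShell θ ((Measure.count : Measure (EuclideanSpace ℝ (Fin 3))).restrict ((fun z => z - x) '' S)) := by
  have hP : IsPointStationaryLaw P := hstat
  -- hard-core configurations are locally finite (finite mass on every norm shell)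
  have hlf : ∀ᵐ μ ∂P, ∀ n : ℕ, μ ((fun z : EuclideanSpace ℝ (Fin 3) => ⌊‖z‖⌋₊) ⁻¹' {n}) < ⊤ := by
    filter_upwards [hroot] with μ hμ n
    obtain ⟨⟨S, -, hsep, rfl⟩, -⟩ := hμ
    have hud : UniformlyDiscrete S := ⟨1 / 3, by norm_num, hsep⟩
    have hfin : (S ∩ Metric.closedBall (0 : EuclideanSpace ℝ (Fin 3)) ((n : ℝ) + 1)).Finite :=
      hud.finite_inter_closedBall 0 ((n : ℝ) + 1)
    rw [Measure.restrict_apply (measurableSet_floorNorm_preimage n)]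
    have hsub : (fun z : EuclideanSpace ℝ (Fin 3) => ⌊‖z‖⌋₊) ⁻¹' {n} ∩ S ⊆
        S ∩ Metric.closedBall (0 : EuclideanSpace ℝ (Fin 3)) ((n : ℝ) + 1) :=
      fun z hz => ⟨hz.2, floorNorm_preimage_subset_closedBall n hz.1⟩
    exact (measure_mono hsub).trans_lt (Measure.count_apply_lt_top.2 hfin)
  have hall := hP.ae_forall_map_sub hlf (p := LooseGoodShell θ) (hroot.mono fun μ hμ => hμ.2)
  filter_upwards [hroot, hall] with μ hμ hμall
  obtain ⟨⟨S, h0, hsep, rfl⟩, -⟩ := hμ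
  refine ⟨S, h0, hsep, rfl, fun x hx => ?_⟩
  have h := hμall x ((count_restrict_singleton_ne_zero_iff S x).2 hx)
  rwa [map_sub_count_restrict] at h

/-- **B + C + everything-shows-at-the-root ⇒ the ROOT-level law gap** (the hypothesis of Stub D'): a law a.s. rooted hard-core
with `(3/2048)/2^k`-good ROOT shell and point-stationary is a.s. everywhere `(3/2048)/2^k`-good (`ae_forall_looseGoodShell`),
hence everywhere `3/2048`-good (`looseGoodShell_mono`), hence charted by Stub B, so Stub C applies. -/
theorem lawGapRoot_of_chart_and_elastic
    (hB : ∀ S : Set (EuclideanSpace ℝ (Fin 3)), S.Nonempty →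
      (∀ x ∈ S, LooseGoodShell (3 / 2048)
        ((Measure.count : Measure (EuclideanSpace ℝ (Fin 3))).restrict ((fun z => z - x) '' S))) →
      ∃ s : ℤ → ℤ, IsHaggSeq s ∧
        ∃ Φ : EuclideanSpace ℝ (Fin 3) → EuclideanSpace ℝ (Fin 3),
          Set.BijOn Φ (barlowStacking 1 (Real.sqrt (2 / 3)) s) S ∧
          ∀ p ∈ barlowStacking 1 (Real.sqrt (2 / 3)) s, ∀ q ∈ barlowStacking 1 (Real.sqrt (2 / 3)) s,
            (dist p q = 1 ↔ (0 < dist (Φ p) (Φ q) ∧ dist (Φ p) (Φ q) ≤ 28 / 25)))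
    (hC : ∀ k : ℕ, ∀ t : ℝ, 0 < t → ∃ κ : ℝ, 0 < κ ∧
      ∀ P : Measure (Measure (EuclideanSpace ℝ (Fin 3))), IsProbabilityMeasure P →
        (∀ᵐ μ ∂P, ∃ S : Set (EuclideanSpace ℝ (Fin 3)), (0 : EuclideanSpace ℝ (Fin 3)) ∈ S ∧
            (∀ x ∈ S, ∀ y ∈ S, x ≠ y → (1 : ℝ) / 3 ≤ dist x y) ∧
            μ = (Measure.count : Measure (EuclideanSpace ℝ (Fin 3))).restrict S ∧
            (∀ x ∈ S, LooseGoodShell ((3 / 2048 : ℝ) / 2 ^ k)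
              ((Measure.count : Measure (EuclideanSpace ℝ (Fin 3))).restrict ((fun z => z - x) '' S))) ∧
            (∃ s : ℤ → ℤ, IsHaggSeq s ∧
              ∃ Φ : EuclideanSpace ℝ (Fin 3) → EuclideanSpace ℝ (Fin 3),
                Set.BijOn Φ (barlowStacking 1 (Real.sqrt (2 / 3)) s) S ∧
                ∀ p ∈ barlowStacking 1 (Real.sqrt (2 / 3)) s, ∀ q ∈ barlowStacking 1 (Real.sqrt (2 / 3)) s,
                  (dist p q = 1 ↔ (0 < dist (Φ p) (Φ q) ∧ dist (Φ p) (Φ q) ≤ 28 / 25)))) →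
        (∀ g : Measure (EuclideanSpace ℝ (Fin 3)) → EuclideanSpace ℝ (Fin 3) → ℝ≥0∞, Measurable (Function.uncurry g) →
            ∫⁻ μ, ∫⁻ y, g μ y ∂μ ∂P = ∫⁻ μ, ∫⁻ y, g (Measure.map (fun z => z - y) μ) (-y) ∂μ ∂P) →
        ∀ B : Set (Measure (EuclideanSpace ℝ (Fin 3))), MeasurableSet B →
          (∀ μ : Measure (EuclideanSpace ℝ (Fin 3)),
              (∃ S : Set (EuclideanSpace ℝ (Fin 3)), (0 : EuclideanSpace ℝ (Fin 3)) ∈ S ∧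
                (∀ x ∈ S, ∀ y ∈ S, x ≠ y → (1 : ℝ) / 3 ≤ dist x y) ∧
                μ = (Measure.count : Measure (EuclideanSpace ℝ (Fin 3))).restrict S) →
              (μ ∈ B ↔ LooseGoodShell ((1 / 4096 : ℝ) / 2 ^ k) μ)) →
          ENNReal.ofReal t ≤ P Bᶜ →
          eStar + κ ≤ ∫ μ, (∫ y, lennardJones ‖y‖ ∂μ) / 2 ∂P)
    (k : ℕ) :
    (∀ t : ℝ, 0 < t → ∃ κ : ℝ, 0 < κ ∧
        ∀ P : Measure (Measure (EuclideanSpace ℝ (Fin 3))), IsProbabilityMeasure P →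
          (∀ᵐ μ ∂P, (∃ S : Set (EuclideanSpace ℝ (Fin 3)), (0 : EuclideanSpace ℝ (Fin 3)) ∈ S ∧
              (∀ x ∈ S, ∀ y ∈ S, x ≠ y → (1 : ℝ) / 3 ≤ dist x y) ∧
              μ = (Measure.count : Measure (EuclideanSpace ℝ (Fin 3))).restrict S) ∧
              LooseGoodShell ((3 / 2048 : ℝ) / 2 ^ k) μ) →
          (∀ g : Measure (EuclideanSpace ℝ (Fin 3)) → EuclideanSpace ℝ (Fin 3) → ℝ≥0∞, Measurable (Function.uncurry g) →
              ∫⁻ μ, ∫⁻ y, g μ y ∂μ ∂P = ∫⁻ μ, ∫⁻ y, g (Measure.map (fun z => z - y) μ) (-y) ∂μ ∂P) →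
          ∀ B : Set (Measure (EuclideanSpace ℝ (Fin 3))), MeasurableSet B →
            (∀ μ : Measure (EuclideanSpace ℝ (Fin 3)),
                (∃ S : Set (EuclideanSpace ℝ (Fin 3)), (0 : EuclideanSpace ℝ (Fin 3)) ∈ S ∧
                  (∀ x ∈ S, ∀ y ∈ S, x ≠ y → (1 : ℝ) / 3 ≤ dist x y) ∧
                  μ = (Measure.count : Measure (EuclideanSpace ℝ (Fin 3))).restrict S) →
                (μ ∈ B ↔ LooseGoodShell ((1 / 4096 : ℝ) / 2 ^ k) μ)) →
            ENNReal.ofReal t ≤ P Bᶜ →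
            eStar + κ ≤ ∫ μ, (∫ y, lennardJones ‖y‖ ∂μ) / 2 ∂P) := by
  intro t ht
  obtain ⟨κ, hκ, hκP⟩ := hC k t ht
  refine ⟨κ, hκ, fun P hP hroot hstat B hBm hBiff hmass => hκP P hP ?_ hstat B hBm hBiff hmass⟩
  filter_upwards [ae_forall_looseGoodShell hroot hstat] with μ hμ
  obtain ⟨S, h0, hsep, hμS, hall⟩ := hμ
  refine ⟨S, h0, hsep, hμS, hall, ?_⟩
  exact hB S ⟨0, h0⟩ fun x hx =>
    looseGoodShell_mono (coarseLevel_nonneg k) (coarseLevel_le k) (by norm_num) (hall x hx)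

/-- The ladder of levels: `θ 0 = 1/20`, `θ (j+1) = (1/1024)/2^j`. -/
noncomputable def ladder : ℕ → ℝ := fun j => Nat.rec (1 / 20 : ℝ) (fun i _ => (1 / 1024 : ℝ) / 2 ^ i) j

@[simp] theorem ladder_zero : ladder 0 = 1 / 20 := rfl

@[simp] theorem ladder_succ (j : ℕ) : ladder (j + 1) = (1 / 1024 : ℝ) / 2 ^ j := rfl

theorem ladder_pos (j : ℕ) : 0 < ladder j := by
  cases j with
  | zero => rw [ladder_zero]; norm_num
  | succ i => rw [ladder_succ]; positivity

theorem ladder_succ_succ_eq (j : ℕ) : ladder (j + 2) = ladder (j + 1) / 2 := by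
  rw [ladder_succ, ladder_succ, pow_succ]
  ring

theorem ladder_anti : ∀ j : ℕ, ladder (j + 1) ≤ ladder j := by
  intro j
  cases j with
  | zero => rw [ladder_zero, ladder_succ]; norm_num
  | succ i =>
    rw [show i + 1 + 1 = i + 2 from rfl, ladder_succ_succ_eq]
    have := ladder_pos (i + 1)
    linarith

theorem ladder_reach : ∀ θ' : ℝ, 0 < θ' → ∃ j, ladder j ≤ θ' := by
  intro θ' hθ'
  obtain ⟨j, hj⟩ := dyadic_reach θ' hθ'
  refine ⟨j + 1, ?_⟩
  rw [ladder_succ]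
  have h1 : (1 / 1024 : ℝ) / 2 ^ j ≤ (1 / 20 : ℝ) / 2 ^ j :=
    div_le_div_of_nonneg_right (by norm_num) (by positivity)
  exact h1.trans hj

/-- Shallow rung + deep rungs = every rung of the ladder. -/
theorem ladder_rungs (hS : CoarseToFineAt (1 / 20) (1 / 1024))
    (hdeep : ∀ k : ℕ, CoarseToFineAt ((1 / 1024 : ℝ) / 2 ^ k) ((1 / 1024 : ℝ) / 2 ^ (k + 1))) :
    ∀ j : ℕ, CoarseToFineAt (ladder j) (ladder (j + 1)) := by
  intro j
  cases j with
  | zero =>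
    rw [ladder_zero, ladder_succ, pow_zero, div_one]
    exact hS
  | succ i =>
    rw [ladder_succ, show i + 1 + 1 = i + 2 from rfl, ladder_succ]
    exact hdeep i

/-- **The composition (kernel-checked): Stubs A, S, B, C, D' ⇒ the crux `MinimiserShells`, by name.** -/
theorem MinimiserShells_of
    (hA : LennardJonesCoarseShellGapConjecture)
    (hS : CoarseToFineAt (1 / 20) (1 / 1024))
    (hB : ∀ S : Set (EuclideanSpace ℝ (Fin 3)), S.Nonempty →
      (∀ x ∈ S, LooseGoodShell (3 / 2048)
        ((Measure.count : Measure (EuclideanSpace ℝ (Fin 3))).restrict ((fun z => z - x) '' S))) →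
      ∃ s : ℤ → ℤ, IsHaggSeq s ∧
        ∃ Φ : EuclideanSpace ℝ (Fin 3) → EuclideanSpace ℝ (Fin 3),
          Set.BijOn Φ (barlowStacking 1 (Real.sqrt (2 / 3)) s) S ∧
          ∀ p ∈ barlowStacking 1 (Real.sqrt (2 / 3)) s, ∀ q ∈ barlowStacking 1 (Real.sqrt (2 / 3)) s,
            (dist p q = 1 ↔ (0 < dist (Φ p) (Φ q) ∧ dist (Φ p) (Φ q) ≤ 28 / 25)))
    (hC : ∀ k : ℕ, ∀ t : ℝ, 0 < t → ∃ κ : ℝ, 0 < κ ∧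
      ∀ P : Measure (Measure (EuclideanSpace ℝ (Fin 3))), IsProbabilityMeasure P →
        (∀ᵐ μ ∂P, ∃ S : Set (EuclideanSpace ℝ (Fin 3)), (0 : EuclideanSpace ℝ (Fin 3)) ∈ S ∧
            (∀ x ∈ S, ∀ y ∈ S, x ≠ y → (1 : ℝ) / 3 ≤ dist x y) ∧
            μ = (Measure.count : Measure (EuclideanSpace ℝ (Fin 3))).restrict S ∧
            (∀ x ∈ S, LooseGoodShell ((3 / 2048 : ℝ) / 2 ^ k)
              ((Measure.count : Measure (EuclideanSpace ℝ (Fin 3))).restrict ((fun z => z - x) '' S))) ∧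
            (∃ s : ℤ → ℤ, IsHaggSeq s ∧
              ∃ Φ : EuclideanSpace ℝ (Fin 3) → EuclideanSpace ℝ (Fin 3),
                Set.BijOn Φ (barlowStacking 1 (Real.sqrt (2 / 3)) s) S ∧
                ∀ p ∈ barlowStacking 1 (Real.sqrt (2 / 3)) s, ∀ q ∈ barlowStacking 1 (Real.sqrt (2 / 3)) s,
                  (dist p q = 1 ↔ (0 < dist (Φ p) (Φ q) ∧ dist (Φ p) (Φ q) ≤ 28 / 25)))) →
        (∀ g : Measure (EuclideanSpace ℝ (Fin 3)) → EuclideanSpace ℝ (Fin 3) → ℝ≥0∞, Measurable (Function.uncurry g) →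
            ∫⁻ μ, ∫⁻ y, g μ y ∂μ ∂P = ∫⁻ μ, ∫⁻ y, g (Measure.map (fun z => z - y) μ) (-y) ∂μ ∂P) →
        ∀ B : Set (Measure (EuclideanSpace ℝ (Fin 3))), MeasurableSet B →
          (∀ μ : Measure (EuclideanSpace ℝ (Fin 3)),
              (∃ S : Set (EuclideanSpace ℝ (Fin 3)), (0 : EuclideanSpace ℝ (Fin 3)) ∈ S ∧
                (∀ x ∈ S, ∀ y ∈ S, x ≠ y → (1 : ℝ) / 3 ≤ dist x y) ∧
                μ = (Measure.count : Measure (EuclideanSpace ℝ (Fin 3))).restrict S) →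
              (μ ∈ B ↔ LooseGoodShell ((1 / 4096 : ℝ) / 2 ^ k) μ)) →
          ENNReal.ofReal t ≤ P Bᶜ →
          eStar + κ ≤ ∫ μ, (∫ y, lennardJones ‖y‖ ∂μ) / 2 ∂P)
    (hD : ∀ k : ℕ,
      (∀ t : ℝ, 0 < t → ∃ κ : ℝ, 0 < κ ∧
        ∀ P : Measure (Measure (EuclideanSpace ℝ (Fin 3))), IsProbabilityMeasure P →
          (∀ᵐ μ ∂P, (∃ S : Set (EuclideanSpace ℝ (Fin 3)), (0 : EuclideanSpace ℝ (Fin 3)) ∈ S ∧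
              (∀ x ∈ S, ∀ y ∈ S, x ≠ y → (1 : ℝ) / 3 ≤ dist x y) ∧
              μ = (Measure.count : Measure (EuclideanSpace ℝ (Fin 3))).restrict S) ∧
              LooseGoodShell ((3 / 2048 : ℝ) / 2 ^ k) μ) →
          (∀ g : Measure (EuclideanSpace ℝ (Fin 3)) → EuclideanSpace ℝ (Fin 3) → ℝ≥0∞, Measurable (Function.uncurry g) →
              ∫⁻ μ, ∫⁻ y, g μ y ∂μ ∂P = ∫⁻ μ, ∫⁻ y, g (Measure.map (fun z => z - y) μ) (-y) ∂μ ∂P) →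
          ∀ B : Set (Measure (EuclideanSpace ℝ (Fin 3))), MeasurableSet B →
            (∀ μ : Measure (EuclideanSpace ℝ (Fin 3)),
                (∃ S : Set (EuclideanSpace ℝ (Fin 3)), (0 : EuclideanSpace ℝ (Fin 3)) ∈ S ∧
                  (∀ x ∈ S, ∀ y ∈ S, x ≠ y → (1 : ℝ) / 3 ≤ dist x y) ∧
                  μ = (Measure.count : Measure (EuclideanSpace ℝ (Fin 3))).restrict S) →
                (μ ∈ B ↔ LooseGoodShell ((1 / 4096 : ℝ) / 2 ^ k) μ)) →
            ENNReal.ofReal t ≤ P Bᶜ →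
            eStar + κ ≤ ∫ μ, (∫ y, lennardJones ‖y‖ ∂μ) / 2 ∂P) →
      CoarseToFineAt ((1 / 1024 : ℝ) / 2 ^ k) ((1 / 1024 : ℝ) / 2 ^ (k + 1))) :
    MinimiserShells := by
  -- deep rungs from B + C + D' (the Mecke upgrade is `ae_forall_looseGoodShell`, inside `lawGapRoot_of_chart_and_elastic`)
  have hdeep : ∀ k : ℕ, CoarseToFineAt ((1 / 1024 : ℝ) / 2 ^ k) ((1 / 1024 : ℝ) / 2 ^ (k + 1)) := fun k =>
    hD k (lawGapRoot_of_chart_and_elastic hB hC k)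
  -- all rungs of the ladder, then the `1/20`-to-every-level transfer
  have hchild : ∀ θ' : ℝ, 0 < θ' → θ' ≤ 1 / 20 → CoarseToFineAt (1 / 20) θ' :=
    child_of_ladder ladder ladder_zero (fun j => (ladder_pos j).le) ladder_anti ladder_reach (ladder_rungs hS hdeep)
  -- the coarse gap from the conjecture, then all levels, then the crux
  have hcoarse : ShellGap (1 / 20) := lennardJonesCoarseShellGapConjecture_iff_shellGap.1 hA
  exact minimiserShells_of_shellGapAll (shellGapAll_of_coarse_and_child hcoarse hchild)

/-- Hypothesis-free form over the stubs (for the skeleton audit: concludes the crux decl by name; sorries only in `stub_*`). -/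
theorem MinimiserShells_proof : MinimiserShells :=
  MinimiserShells_of stub_lennardJonesCoarseShellGapConjecture stub_shallowRungs stub_fineBarlowChart
    stub_stationaryElasticGap stub_palmTransferRoot

end Summit.AtomisticToContinuum.Crystallization.Cruxes.MinimiserShells.PalmElasticTail
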